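import Summits.QuantumFields.BalabanUV.Gaps.EndDrawdownLinearBarrier

/-!
# Gaps / EndDrawdownLinearSegmentBarrier — PIECEWISE-LINEAR BARRIERS FROM SEGMENT DATA: a general constructor for the barrier criterion
# (`EndDrawdownLinearBarrier.endPossibleLin_iff_barrier`).  Data: breakpoints `N : ℕ → ℕ` strictly increasing with `N 0 = 0`, heights `H : ℕ → ℝ`
# non-decreasing, bounded by `Ytop`, with foot `H 0 ≥ A > 0`; the interpolant `ℓ` is linear on each segment `[N k, N (k+1)]`.  **`isBarrier_segInterp`**: if on
# every segment the slope `(H(k+1) − H k)∕(N(k+1) − N k)` is at least `−b_i − C∕√H(k+1)` for each index `i` of the segment (the help evaluated at the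
# segment's TOP, where it is least), then `ℓ` is a barrier between `A` and `Ytop`.  This is the engine behind the sufficiency half of the renormalisation
# squeeze with any number of Euler pieces per block (cell pub-balaban-gaps, seat g1-p3 GEN 11, rows CAP ∕ tail ∕ (D4) «split ∕ weakening»; this seat's
# own leaf; file 29 of «the one-loop interface of the END statement»)

HONEST FRAMING (cell rule, page 1 of everything): [folklore] bookkeeping (linear interpolation and one monotonicity); `EndPossibleLin` ∕ barriers are
READINGS of the cell's END-grade statement over Bałaban-free data; NOTHING of Bałaban's table is certified; words ∕ odds of rows CAP ∕ tail ∕ (D4) ∕ (D1)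
UNCHANGED; 0∕6 binders; one finite T⁴; NOT [I] Thm 2, NOT `BetaPertH`, NOT the continuum limit, NOT Clay.

CITATION HEADER (tags CONTEXT ONLY).  [I] = T. Bałaban, Commun. Math. Phys. **109** (1987) 249–301 [Balaban1987RG1]: (0.20) p. 256, Thm 2
p. 259 (first sentence), (2.12)–(2.14) p. 268.
-/

namespace Summit.QuantumFields.BalabanUV.Gaps.EndDrawdownLinearSegmentBarrier

open Summit.QuantumFields.BalabanUV.Gaps.EndDrawdownLinearRoad
open Summit.QuantumFields.BalabanUV.Gaps.EndDrawdownLinearBarrier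

noncomputable section

variable {b : ℕ → ℝ} {C : ℝ}

/-! ## §1 Segments -/

section Seg

variable (N : ℕ → ℕ) (hN0 : N 0 = 0) (hN : StrictMono N)
include hN0 hN

omit hN0 in
/-- Every index lies below some later breakpoint. [folklore] -/
theorem exists_lt_N (i : ℕ) : ∃ k, i < N (k + 1) := ⟨i, Nat.lt_of_lt_of_le (Nat.lt_succ_self i) (hN.le_apply (x := i + 1))⟩

/-- THE SEGMENT of an index: the least `k` with `i < N (k+1)`. [folklore] -/
def seg (i : ℕ) : ℕ := Nat.find (exists_lt_N N hN i)

omit hN0 in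
/-- `i < N (seg i + 1)`. [folklore] -/
theorem lt_N_seg_succ (i : ℕ) : i < N (seg N hN i + 1) := Nat.find_spec (exists_lt_N N hN i)

/-- `N (seg i) ≤ i`. [folklore] -/
theorem N_seg_le (i : ℕ) : N (seg N hN i) ≤ i := by
  rcases Nat.eq_zero_or_pos (seg N hN i) with h | h
  · rw [h, hN0]; exact Nat.zero_le _
  · have hmin := Nat.find_min (exists_lt_N N hN i) (m := seg N hN i - 1) (Nat.sub_lt h Nat.one_pos)
    rw [show seg N hN i - 1 + 1 = seg N hN i from Nat.sub_add_cancel h] at hmin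
    exact not_lt.mp hmin

/-- Characterisation: `seg i = k ⟺ N k ≤ i < N (k+1)`. [folklore] -/
theorem seg_eq_of_mem {i k : ℕ} (h1 : N k ≤ i) (h2 : i < N (k + 1)) : seg N hN i = k := by
  have hA := lt_N_seg_succ N hN i
  have hB := N_seg_le N hN0 hN i
  by_contra hne
  rcases Nat.lt_or_gt_of_ne hne with hlt | hgt
  · -- seg i < k ⟹ N (seg i + 1) ≤ N k ≤ i, contradiction
    have : N (seg N hN i + 1) ≤ N k := hN.monotone (by omega)
    omega
  · have : N (k + 1) ≤ N (seg N hN i) := hN.monotone (by omega)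
    omega

/-- The next index stays in the segment or opens the next one. [folklore] -/
theorem seg_succ (i : ℕ) : (seg N hN (i + 1) = seg N hN i ∧ i + 1 < N (seg N hN i + 1)) ∨
    (seg N hN (i + 1) = seg N hN i + 1 ∧ i + 1 = N (seg N hN i + 1)) := by
  have hA := lt_N_seg_succ N hN i
  have hB := N_seg_le N hN0 hN i
  by_cases h : i + 1 < N (seg N hN i + 1)
  · exact Or.inl ⟨seg_eq_of_mem N hN0 hN (by omega) h, h⟩
  · have heq : i + 1 = N (seg N hN i + 1) := by omega
    refine Or.inr ⟨seg_eq_of_mem N hN0 hN (by omega) ?_, heq⟩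
    have : N (seg N hN i + 1) < N (seg N hN i + 1 + 1) := hN (by omega)
    omega

end Seg

/-! ## §2 The interpolant and the barrier property -/

section Interp

variable (N : ℕ → ℕ) (hN0 : N 0 = 0) (hN : StrictMono N) (H : ℕ → ℝ)

/-- Segment slopes. [folklore] -/
def segSlope (k : ℕ) : ℝ := (H (k + 1) - H k) / ((N (k + 1) - N k : ℕ) : ℝ)

/-- THE PIECEWISE-LINEAR INTERPOLANT of the heights `H` at the breakpoints `N`. [folklore] -/
def segInterp (i : ℕ) : ℝ := H (seg N hN i) + ((i - N (seg N hN i) : ℕ) : ℝ) * segSlope N H (seg N hN i)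

include hN0 hN

omit hN0 in
/-- Segment lengths are positive. [folklore] -/
theorem segLen_pos (k : ℕ) : (0 : ℝ) < ((N (k + 1) - N k : ℕ) : ℝ) := by
  have := hN (show k < k + 1 by omega); exact_mod_cast (show 0 < N (k + 1) - N k by omega)

omit hN0 in
/-- `H (k+1) = H k + len_k · slope_k`. [folklore] -/
theorem H_succ_eq (k : ℕ) : H (k + 1) = H k + ((N (k + 1) - N k : ℕ) : ℝ) * segSlope N H k := by
  unfold segSlope; field_simp [(segLen_pos N hN k).ne']; ring

/-- The interpolant steps by the slope of its segment. [folklore] -/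
theorem segInterp_succ (i : ℕ) : segInterp N hN H (i + 1) = segInterp N hN H i + segSlope N H (seg N hN i) := by
  have hB := N_seg_le N hN0 hN i
  rcases seg_succ N hN0 hN i with ⟨hs, _⟩ | ⟨hs, heq⟩
  · unfold segInterp; rw [hs, show i + 1 - N (seg N hN i) = (i - N (seg N hN i)) + 1 by omega]; push_cast; ring
  · unfold segInterp
    rw [hs, ← heq, Nat.sub_self, Nat.cast_zero, zero_mul, add_zero, H_succ_eq N hN H (seg N hN i)]
    have hlen : ((i - N (seg N hN i) : ℕ) : ℝ) = ((N (seg N hN i + 1) - N (seg N hN i) : ℕ) : ℝ) - 1 := by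
      rw [show i - N (seg N hN i) = N (seg N hN i + 1) - N (seg N hN i) - 1 by omega,
        Nat.cast_sub (by omega), Nat.cast_one]
    rw [hlen]; ring

/-- With non-decreasing heights the interpolant sits between consecutive heights. [folklore] -/
theorem H_le_segInterp_le (hH : Monotone H) (i : ℕ) :
    H (seg N hN i) ≤ segInterp N hN H i ∧ segInterp N hN H i ≤ H (seg N hN i + 1) := by
  have hA := lt_N_seg_succ N hN i
  have hB := N_seg_le N hN0 hN i
  have hσ : 0 ≤ segSlope N H (seg N hN i) :=
    div_nonneg (by linarith [hH (Nat.le_succ (seg N hN i))]) (segLen_pos N hN (seg N hN i)).le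
  refine ⟨le_add_of_nonneg_right (mul_nonneg (Nat.cast_nonneg _) hσ), ?_⟩
  unfold segInterp
  rw [H_succ_eq N hN H (seg N hN i)]
  have hlen : ((i - N (seg N hN i) : ℕ) : ℝ) ≤ ((N (seg N hN i + 1) - N (seg N hN i) : ℕ) : ℝ) := by
    exact_mod_cast (show i - N (seg N hN i) ≤ N (seg N hN i + 1) - N (seg N hN i) by omega)
  linarith [mul_le_mul_of_nonneg_right hlen hσ]

/-- **THE SEGMENT BARRIER** · breakpoints `N` (strictly increasing, `N 0 = 0`), heights `H` non-decreasing with `A ≤ H 0`, `0 < A`, `H k ≤ Ytop`; if on every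
segment the slope dominates `−b_i − C∕√H(k+1)` (`C ≥ 0`; the help taken at the segment's top), then the interpolant is a barrier between `A` and `Ytop`.
[folklore] -/
theorem isBarrier_segInterp (hC : 0 ≤ C) (hH : Monotone H) {A Ytop : ℝ} (hA : 0 < A) (hA0 : A ≤ H 0) (hY : ∀ k, H k ≤ Ytop)
    (hslope : ∀ k i, N k ≤ i → i < N (k + 1) → -b i - C / Real.sqrt (H (k + 1)) ≤ segSlope N H k) :
    IsBarrier b C A Ytop (segInterp N hN H) := by
  have hlow : ∀ i, A ≤ segInterp N hN H i := fun i =>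
    (hA0.trans (hH (Nat.zero_le _))).trans (H_le_segInterp_le N hN0 hN H hH i).1
  refine ⟨hlow, fun i => (H_le_segInterp_le N hN0 hN H hH i).2.trans (hY _), fun i => ?_⟩
  rw [segInterp_succ N hN0 hN H i]
  have hup := (H_le_segInterp_le N hN0 hN H hH i).2
  have hpos : 0 < segInterp N hN H i := hA.trans_le (hlow i)
  have hhelp : C / Real.sqrt (H (seg N hN i + 1)) ≤ C / Real.sqrt (segInterp N hN H i) :=
    div_le_div_of_nonneg_left hC (Real.sqrt_pos.mpr hpos) (Real.sqrt_le_sqrt hup)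
  have hs := hslope (seg N hN i) i (N_seg_le N hN0 hN i) (lt_N_seg_succ N hN i)
  linarith

end Interp

/-- **POSSIBILITY FROM SEGMENT DATA AT EVERY LEVEL** (`C ≥ 0`, every box). [cite: Balaban1987RG1, Thm 2 p.259 (first sentence) and (2.12)–(2.14) p.268] -/
theorem endPossibleLin_of_segments (hC : 0 ≤ C) {γ₀ : ℝ} (hγ₀ : 0 < γ₀)
    (h : ∀ A : ℝ, 0 < A → ∃ (N : ℕ → ℕ) (_ : N 0 = 0) (_ : StrictMono N) (H : ℕ → ℝ) (Ytop : ℝ), Monotone H ∧ A ≤ H 0 ∧ (∀ k, H k ≤ Ytop) ∧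
      ∀ k i, N k ≤ i → i < N (k + 1) → -b i - C / Real.sqrt (H (k + 1)) ≤ segSlope N H k) :
    EndPossibleLin b C γ₀ :=
  (endPossibleLin_iff_barrier hC hγ₀).mpr fun A hA => by
    obtain ⟨N, hN0, hN, H, Ytop, hH, hA0, hY, hslope⟩ := h A hA
    exact ⟨Ytop, segInterp N hN H, isBarrier_segInterp N hN0 hN H hC hH hA hA0 hY hslope⟩


/-! ## §3 (v1.1, append-only) Values at the breakpoints -/

/-- At a breakpoint the interpolant takes the prescribed height: `segInterp (N k) = H k`. [folklore] -/
theorem segInterp_breakpoint (N : ℕ → ℕ) (hN0 : N 0 = 0) (hN : StrictMono N) (H : ℕ → ℝ) (k : ℕ) :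
    segInterp N hN H (N k) = H k := by
  have hk : seg N hN (N k) = k := seg_eq_of_mem N hN0 hN le_rfl (hN (Nat.lt_succ_self k))
  unfold segInterp; rw [hk, Nat.sub_self]; simp

end

end Summit.QuantumFields.BalabanUV.Gaps.EndDrawdownLinearSegmentBarrier
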